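import Literature.Computability.Cryptography.FpGoldreichLevinDirectProduct
import Literature.Computability.MetaComplexity.GFDesignList
import Mathlib.Data.Nat.Dist
import HarnessLib

/-!
# The `𝔽_p`-Goldreich–Levin candidate as an explicit finite recipe

Machine-layer groundwork for the named fact `Literature.Computability.Learning.cikk_learn_AC0Mod`
(CIKK 2016, Cor. 5.4). The candidate `glCandG` of `FpGoldreichLevinDirectProduct.lean` (the
`𝔽_p` Goldreich–Levin decoder driven by a guess, CIKK Thm. 4.2 / Claim 4.4) is defined with a
real threshold and a `Classical.choose` of the least passing value. This file restates it as the
finite recipe the hypothesis evaluator runs: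

* `digitsFun`, `repsList p kk` — the canonical coefficient vectors (`reps`) ENUMERATED through the
  base-`p` digits of `N < p^{kk}` (`repsList_nodup`, `mem_repsList`, `length_filter_repsList`);
* `glCandN kk B σ θN θD s` — histograms as counts over `repsList`, the alignment test with the
  rational threshold `θN/θD` cleared of denominators (`|h_I - h_0| · θD ≤ 2 θN · #reps` in `ℕ`),
  the least passing value by `findIdx` over `0, …, p-1`;
* **`glCandN_eq`** — `glCandN kk B σ θN θD s = glCandG kk B σ (θN/θD) s` (`θD > 0`).

## References

* M. Carmosino, R. Impagliazzo, V. Kabanets, A. Kolokolova, *Learning algorithms from natural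
  proofs*, CCC 2016, Thm. 4.2, Claim 4.4 [CarmosinoImpagliazzoKabanetsKolokolova2016].
-/

namespace Literature.Computability.Cryptography

open Finset Matrix Function Literature.Computability.MetaComplexity.GFDesign

variable {p : ℕ} [hp : Fact p.Prime] {n kk : ℕ}

/-! ### Enumerating the coefficient vectors -/

/-- The vector of base-`p` digits of `N`. [folklore] -/
def digitsFun (p kk : ℕ) (N : ℕ) : Fin kk → ZMod p := fun t => ((N / p ^ (t : ℕ) % p : ℕ) : ZMod p)

omit hp in
/-- `digitsFun` is `digitsL` read as a function. [folklore] -/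
theorem ofFn_digitsFun (N : ℕ) : List.ofFn (digitsFun p kk N) = digitsL p kk N := rfl

/-- **`digitsFun` is injective below `p^{kk}`.** [folklore] -/
theorem digitsFun_injOn {N M : ℕ} (hN : N < p ^ kk) (hM : M < p ^ kk) (h : digitsFun p kk N = digitsFun p kk M) : N = M := by
  have h' : digitsL p kk N = digitsL p kk M := by rw [← ofFn_digitsFun, ← ofFn_digitsFun, h]
  rw [← idxL_digitsL p hN, ← idxL_digitsL p hM, h']

/-- **`digitsFun` is onto**: every vector is the digit vector of its index. [folklore] -/
theorem digitsFun_idxL (c : Fin kk → ZMod p) : digitsFun p kk (idxL p (List.ofFn c)) = c := by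
  have h := digitsL_idxL p (List.ofFn c)
  rw [List.length_ofFn, ← ofFn_digitsFun] at h
  exact List.ofFn_injective h

/-- The enumeration of all vectors. [folklore] -/
def allVecs (p kk : ℕ) : List (Fin kk → ZMod p) := (List.range (p ^ kk)).map (digitsFun p kk)

/-- The enumeration of all vectors has no duplicates. [folklore] -/
theorem allVecs_nodup : (allVecs p kk).Nodup := by
  rw [allVecs, List.nodup_map_iff_inj_on List.nodup_range]
  intro N hN M hM h
  rw [List.mem_range] at hN hM
  exact digitsFun_injOn hN hM h

/-- Every vector is enumerated. [folklore] -/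
theorem mem_allVecs (c : Fin kk → ZMod p) : c ∈ allVecs p kk := by
  rw [allVecs, List.mem_map]
  refine ⟨idxL p (List.ofFn c), List.mem_range.2 ?_, digitsFun_idxL c⟩
  have h := idxL_lt p (List.ofFn c)
  rwa [List.length_ofFn] at h

/-- **The enumeration of the canonical coefficient vectors** (`reps`). [folklore] -/
def repsList (p kk : ℕ) [Fact p.Prime] : List (Fin kk → ZMod p) := (allVecs p kk).filter fun c => decide (IsRep c)

/-- The enumeration has no duplicates. [folklore] -/
theorem repsList_nodup : (repsList p kk).Nodup := allVecs_nodup.filter _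

/-- The enumeration lists exactly `reps`. [folklore] -/
theorem mem_repsList {c : Fin kk → ZMod p} : c ∈ repsList p kk ↔ c ∈ reps p kk := by
  rw [repsList, List.mem_filter, mem_reps]
  simp [mem_allVecs c]

/-- `repsList` as a finset is `reps`. [folklore] -/
theorem toFinset_repsList : (repsList p kk).toFinset = reps p kk := by
  ext c; rw [List.mem_toFinset, mem_repsList]

/-- **Counting over the enumeration is counting over `reps`.** [folklore] -/
theorem length_filter_repsList (P : (Fin kk → ZMod p) → Prop) [DecidablePred P] :
    ((repsList p kk).filter fun c => decide (P c)).length = ((reps p kk).filter P).card := by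
  rw [← toFinset_repsList, ← List.toFinset_card_of_nodup (repsList_nodup.filter _)]
  congr 1
  ext c
  simp

/-- The length of the enumeration is `#reps`. [folklore] -/
theorem length_repsList : (repsList p kk).length = (reps p kk).card := by
  rw [← toFinset_repsList, List.toFinset_card_of_nodup repsList_nodup]

/-! ### The recipe -/

variable (kk)

/-- The values `B(r_c + eᵢ) - Σ_t c_t σ_t` over the enumeration (`i = none`: no shift). [folklore] -/
def glValues (B : FVec p n → ZMod p) (σ : Fin kk → ZMod p) (s : Fin kk → FVec p n) (i : Option (Fin n)) : List (ZMod p) :=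
  (repsList p kk).map fun c => B (seedComb s c + (match i with | some i => Pi.single i 1 | none => 0)) - guessDot kk σ c

/-- **The alignment test with the denominators cleared**: `|h_I(a+w) - h_0(w)| · θD ≤ 2 θN · #reps`
for all `w`. [cite: CarmosinoImpagliazzoKabanetsKolokolova2016, Thm. 4.2 (algorithm)] -/
def glTestN (B : FVec p n → ZMod p) (σ : Fin kk → ZMod p) (θN θD : ℕ) (s : Fin kk → FVec p n) (i : Fin n) (a : ZMod p) : Bool :=
  decide (∀ w : ZMod p, Nat.dist ((glValues kk B σ s (some i)).count (a + w)) ((glValues kk B σ s none).count w) * θD ≤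
    2 * θN * (repsList p kk).length)

/-- **The recipe of the candidate**: the least value passing the test, `0` if none.
[cite: CarmosinoImpagliazzoKabanetsKolokolova2016, Thm. 4.2 (algorithm)] -/
def glCandN (B : FVec p n → ZMod p) (σ : Fin kk → ZMod p) (θN θD : ℕ) (s : Fin kk → FVec p n) : FVec p n := fun i =>
  if (List.range p).findIdx (fun a : ℕ => glTestN kk B σ θN θD s i (a : ZMod p)) < p then
    (((List.range p).findIdx (fun a : ℕ => glTestN kk B σ θN θD s i (a : ZMod p)) : ℕ) : ZMod p) else 0

/-! ### The recipe is the candidate -/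

/-- The counts over the enumeration are the histograms. [folklore] -/
theorem count_glValues_some (B : FVec p n → ZMod p) (σ : Fin kk → ZMod p) (s : Fin kk → FVec p n) (i : Fin n) (v : ZMod p) :
    (glValues kk B σ s (some i)).count v = histIG kk B σ s i v := by
  rw [glValues, List.count_eq_countP, List.countP_map, List.countP_eq_length_filter, histIG, ← length_filter_repsList]
  exact congrArg List.length (List.filter_congr fun c _ => Bool.eq_iff_iff.2 (by simp))

/-- The counts over the enumeration are the histograms. [folklore] -/
theorem count_glValues_none (B : FVec p n → ZMod p) (σ : Fin kk → ZMod p) (s : Fin kk → FVec p n) (w : ZMod p) :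
    (glValues kk B σ s none).count w = hist0G kk B σ s w := by
  rw [glValues, List.count_eq_countP, List.countP_map, List.countP_eq_length_filter, hist0G, ← length_filter_repsList]
  exact congrArg List.length (List.filter_congr fun c _ => Bool.eq_iff_iff.2 (by simp))

omit hp in
/-- The distance of naturals is the absolute difference. [folklore] -/
theorem cast_natDist (a b : ℕ) : (Nat.dist a b : ℝ) = |(a : ℝ) - b| := by
  rcases le_total a b with h | h
  · rw [Nat.dist_eq_sub_of_le h, Nat.cast_sub h, abs_sub_comm, abs_of_nonneg (by simpa using h)]
  · rw [Nat.dist_comm, Nat.dist_eq_sub_of_le h, Nat.cast_sub h, abs_of_nonneg (by simpa using h)]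

/-- **The cleared test is the alignment test** with threshold `θN/θD`. [folklore] -/
theorem glTestN_eq_true_iff (B : FVec p n → ZMod p) (σ : Fin kk → ZMod p) {θN θD : ℕ} (hθD : 0 < θD)
    (s : Fin kk → FVec p n) (i : Fin n) (a : ZMod p) :
    glTestN kk B σ θN θD s i a = true ↔ AlignTestG kk B σ ((θN : ℝ) / θD) s i a := by
  rw [glTestN, decide_eq_true_eq, AlignTestG]
  refine forall_congr' fun w => ?_
  rw [count_glValues_some, count_glValues_none, length_repsList, ← cast_natDist]
  have hD : (0 : ℝ) < θD := by exact_mod_cast hθD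
  rw [show (2 : ℝ) * ((θN : ℝ) / θD) * (reps p kk).card = (2 * θN * (reps p kk).card : ℕ) / (θD : ℝ) by
    push_cast; field_simp]
  rw [le_div_iff₀ hD]
  exact_mod_cast Iff.rfl

/-- **The recipe is the candidate `glCandG`.** [cite: CarmosinoImpagliazzoKabanetsKolokolova2016, Thm. 4.2] -/
theorem glCandN_eq (B : FVec p n → ZMod p) (σ : Fin kk → ZMod p) {θN θD : ℕ} (hθD : 0 < θD) (s : Fin kk → FVec p n) :
    glCandN kk B σ θN θD s = glCandG kk B σ ((θN : ℝ) / θD) s := by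
  classical
  funext i
  show (if (List.range p).findIdx (fun a : ℕ => glTestN kk B σ θN θD s i (a : ZMod p)) < p then
    (((List.range p).findIdx (fun a : ℕ => glTestN kk B σ θN θD s i (a : ZMod p)) : ℕ) : ZMod p) else 0) = _
  set S := univ.filter fun a : ZMod p => AlignTestG kk B σ ((θN : ℝ) / θD) s i a with hS
  set test : ℕ → Bool := fun a : ℕ => glTestN kk B σ θN θD s i (a : ZMod p) with htest
  have htest_iff : ∀ a : ℕ, test a = true ↔ ((a : ZMod p) ∈ S) := fun a => by
    rw [htest, glTestN_eq_true_iff kk B σ hθD, hS, mem_filter]; simp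
  set a₀ := (List.range p).findIdx test with ha₀
  have hlen : (List.range p).length = p := List.length_range
  unfold glCandG
  by_cases hne : S.Nonempty
  · rw [dif_pos hne]
    -- the chosen element is the least-`val` passing value
    set x := Classical.choose (S.exists_min_image ZMod.val hne) with hx
    obtain ⟨hxS, hxmin⟩ := Classical.choose_spec (S.exists_min_image ZMod.val hne)
    -- `findIdx` finds something: `x.val` passes
    have hxval : test x.val = true := by rw [htest_iff, ZMod.natCast_zmod_val]; exact hxS
    have ha₀lt : a₀ < p := by
      have h : a₀ < (List.range p).length := List.findIdx_lt_length_of_exists ⟨x.val, List.mem_range.2 x.val_lt, hxval⟩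
      rwa [hlen] at h
    rw [if_pos ha₀lt]
    -- `a₀` passes, so `x.val ≤ a₀`; everything below `a₀` fails, so `a₀ ≤ x.val`
    have ha₀pass : test a₀ = true := by
      have h := List.findIdx_getElem (xs := List.range p) (p := test) (w := by rw [hlen]; exact ha₀lt)
      simpa [ha₀] using h
    have h1 : x.val ≤ a₀ := by
      have := hxmin _ ((htest_iff a₀).1 ha₀pass)
      rwa [ZMod.val_natCast, Nat.mod_eq_of_lt ha₀lt] at this
    have h2 : a₀ ≤ x.val := by
      by_contra hlt
      rw [not_le] at hlt
      have h := List.not_of_lt_findIdx (xs := List.range p) (p := test) (by rw [← ha₀]; exact hlt)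
      rw [List.getElem_range] at h
      rw [h] at hxval
      exact Bool.false_ne_true hxval
    have : a₀ = x.val := le_antisymm h2 h1
    rw [this, ZMod.natCast_zmod_val]
  · rw [dif_neg hne]
    have hnone : ¬ a₀ < p := by
      intro hlt
      have ha₀pass : test a₀ = true := by
        have h := List.findIdx_getElem (xs := List.range p) (p := test) (w := by rw [hlen]; exact hlt)
        simpa [ha₀] using h
      exact hne ⟨_, (htest_iff a₀).1 ha₀pass⟩
    rw [if_neg hnone]

end Literature.Computability.Cryptography
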